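import Literature.Topology.FourManifolds.TautFoliations
import HarnessLib

/-!
# Gluing `C⁰` codimension-one foliations along open embeddings; transport along homeomorphisms

Topic `Literature/Topology/FourManifolds`; fact seat
`provefact-Literature.Topology.FourManifolds.Knot.exists_isTaut_hasCompactLeafOfGenus_of_isIntegralSurgery_zero`
(Gabai, J. Differential Geom. 26 (1987), Cor. 8.2). The printed proof of Cor. 8.2 (p. 525) ends
with a gluing step — "Cap off leaves of `𝓕′|∂N(k)` by discs to extend `𝓕′` to a taut foliation `𝓕`
on `M`" — i.e. the foliation of the zero frame surgery `M = (S³ - N̊(k)) ∪ (D² × S¹)` is the union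
of a foliation of the knot exterior and the foliation of the solid torus by meridian discs, which
agree where the two pieces overlap. In the tree a surgered manifold is an *open gluing*
(`Literature.Topology.FourManifolds.IsOpenGluing`, `IsOpenGluingWith`): two open embeddings
`jA : A → M`, `jB : Bm → M` covering `M`, identified along a partial homeomorphism `T` of the
pieces. This file supplies the corresponding operations on the `C⁰` foliated atlases of
`TautFoliations.lean` (`Literature.Topology.FourManifolds.Foliation`), with complete proofs:

* `Foliation.RelCompat r e e'` (**definition**): the flow box `e'` is *compatible* with the flow
  box `e` for the relation `r` on heights — near every point of the overlap, `r`-related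
  `e`-heights give `r`-related `e'`-heights. For `r` equality this is the plaque condition
  `Foliation.locally_plaque` (`locally_plaque_iff`), for `r = (· < ·)` the transverse orientation
  condition `Foliation.IsTransverselyOriented` (`isTransverselyOriented_iff`).
* `RelCompat.lift`, `RelCompat.lift_of_trans`, `RelCompat.lift_of_trans'` (**proved**):
  compatibility is transported along an open embedding `j` (flow boxes `e.lift_openEmbedding`,
  Mathlib), and *across* two open embeddings `jA`, `jB` glued along `T`
  (`jA a = jB b ↔ a ∈ T.source ∧ T a = b`) from compatibility of `e` with `T.trans e'` on `A`.
* `Foliation.liftAtlas F hj` (**definition**): the flow boxes of a foliation `F` of `A` pushed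
  forward along an open embedding `j : A → M`; they cover `range j`, are pairwise compatible, and
  inside any foliation `G` of `M` containing them, `j` maps plaques into plaques, leaves into
  leaves (`image_leaf_subset_leaf`) and closed transversals to closed transversals
  (`IsClosedTransversal.comp_of_liftAtlas_subset`).
* `Foliation.map F φ` (**definition**): transport of a foliation along a homeomorphism
  `φ : M ≃ₜ N`; `leaf_map` (leaves are the images of leaves), `isTransverselyOriented_map`,
  `isTaut_map`, `HasCompactLeafOfGenus.map` (**proved**).
* `Foliation.glue FA FB hjA hjB hcov T hT hc` (**definition**): the foliation of `M` glued from
  foliations `FA` of `A` and `FB` of `Bm` along an open gluing `(jA, jB, T)`, under the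
  compatibility hypothesis `hc` (every flow box of `FA` is plaque compatible, both ways, with
  every flow box `T.trans e'` of `FB` read through the gluing map); `isTransverselyOriented_glue`
  (oriented pieces with orientation-compatible gluing give an oriented foliation) and
  `isTaut_glue` (**proved**): the glued foliation is taut as soon as `FB` is taut and every leaf
  of `FA` either meets a closed transversal of `FA` or reaches the glued region `T.source` — the
  form in which tautness is checked in Gabai's proof ("by construction every leaf of `𝓕′`
  intersects `∂N(k)` so the core of the filling intersects each leaf of `𝓕`", loc. cit.).

## References

* G. Hector, U. Hirsch, *Introduction to the Geometry of Foliations, Part A*, 2nd ed., Vieweg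
  (1986), Ch. II Def. 2.1.1 (foliated atlases, their equivalence) [HectorHirsch1986].
* D. Gabai, *Foliations and the topology of 3-manifolds. III*, J. Differential Geom. 26 (1987)
  479–536, proof of Cor. 8.2, p. 525 [GabaiJDG1987].

## Design notes

* Everything is stated for a general leaf model `B` (nonempty, for Mathlib's
  `OpenPartialHomeomorph.lift_openEmbedding`) and general topological spaces; nothing is specific
  to 3-manifolds. The directory is that of the definition served.
* The gluing datum is topological: open embeddings `jA`, `jB` with `range jA ∪ range jB = univ`
  and a partial homeomorphism `T` between the pieces with `jA a = jB b ↔ a ∈ T.source ∧ T a = b`;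
  an `IsOpenGluingWith … R jA jB` whose relation `R` is the graph of such a `T` (as for tube
  surgery, `TubeNbhd.tubeSurgeryRel_iff`) provides exactly this.
-/

open scoped Topology
open Function Set Filter Topology

noncomputable section

namespace Literature.Topology.FourManifolds

namespace Foliation

variable {B : Type*} [TopologicalSpace B] {M : Type*} [TopologicalSpace M]
  {N : Type*} [TopologicalSpace N] {A : Type*} [TopologicalSpace A]
  {Bm : Type*} [TopologicalSpace Bm]

/-! ## Compatibility of flow boxes -/

/-- The flow box `e'` is **compatible with the flow box `e` for the relation `r` on heights**:
near every point of `e.source ∩ e'.source`, points whose `e`-heights are `r`-related have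
`r`-related `e'`-heights. For `r = (· = ·)` this is the local plaque condition of a foliated
atlas (the change of coordinates has the form `(x, t) ↦ (α(x, t), γ(t))`, Hector–Hirsch, Ch. II
Def. 2.1.1), for `r = (· < ·)` it says moreover that `γ` is increasing. [folklore] -/
def RelCompat (r : ℝ → ℝ → Prop) (e e' : OpenPartialHomeomorph M (B × ℝ)) : Prop :=
  ∀ x ∈ e.source ∩ e'.source, ∃ U ∈ 𝓝 x,
    ∀ y ∈ U ∩ (e.source ∩ e'.source), ∀ z ∈ U ∩ (e.source ∩ e'.source),
      r (e y).2 (e z).2 → r (e' y).2 (e' z).2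

/-- The plaque condition of a foliated atlas is pairwise compatibility of its flow boxes for
equality of heights (definitional unfolding). [folklore] -/
theorem locally_plaque_iff (F : Foliation B M) {e e' : OpenPartialHomeomorph M (B × ℝ)}
    (he : e ∈ F.atlas) (he' : e' ∈ F.atlas) : RelCompat (· = ·) e e' :=
  F.locally_plaque e he e' he'

/-- Transverse orientation of a foliated atlas is pairwise compatibility of its flow boxes for
`<` on heights (definitional unfolding). [folklore] -/
theorem isTransverselyOriented_iff (F : Foliation B M) :
    F.IsTransverselyOriented ↔ ∀ e ∈ F.atlas, ∀ e' ∈ F.atlas, RelCompat (· < ·) e e' :=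
  Iff.rfl

/-- Every flow box is compatible with itself, for any relation. [folklore] -/
theorem RelCompat.refl (r : ℝ → ℝ → Prop) (e : OpenPartialHomeomorph M (B × ℝ)) :
    RelCompat r e e := fun _ _ ↦ ⟨univ, univ_mem, fun _ _ _ _ h ↦ h⟩

/-- Compatibility for a family that is the union of two families: it suffices to check it
within each family and across the two families in both directions. [folklore] -/
theorem relCompat_union {r : ℝ → ℝ → Prop} {𝒜 ℬ : Set (OpenPartialHomeomorph M (B × ℝ))}
    (h𝒜 : ∀ e ∈ 𝒜, ∀ e' ∈ 𝒜, RelCompat r e e') (hℬ : ∀ e ∈ ℬ, ∀ e' ∈ ℬ, RelCompat r e e')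
    (h𝒜ℬ : ∀ e ∈ 𝒜, ∀ e' ∈ ℬ, RelCompat r e e' ∧ RelCompat r e' e) :
    ∀ e ∈ 𝒜 ∪ ℬ, ∀ e' ∈ 𝒜 ∪ ℬ, RelCompat r e e' := by
  rintro e (he | he) e' (he' | he')
  · exact h𝒜 e he e' he'
  · exact (h𝒜ℬ e he e' he').1
  · exact (h𝒜ℬ e' he' e he).2
  · exact hℬ e he e' he'

section Lift

variable [Nonempty B]

/-- **Compatibility is transported along an open embedding**: if `e'` is compatible with `e` on
`A`, then the pushed-forward flow boxes `e.lift_openEmbedding hj`, `e'.lift_openEmbedding hj` on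
`M` (sources `j '' e.source`, `j '' e'.source`, Mathlib) are compatible. [folklore] -/
theorem RelCompat.lift {j : A → M} (hj : IsOpenEmbedding j) {r : ℝ → ℝ → Prop}
    {e e' : OpenPartialHomeomorph A (B × ℝ)} (h : RelCompat r e e') :
    RelCompat r (e.lift_openEmbedding hj) (e'.lift_openEmbedding hj) := by
  rintro x ⟨hx, hx'⟩
  rw [OpenPartialHomeomorph.lift_openEmbedding_source] at hx hx'
  obtain ⟨a, ha, rfl⟩ := hx
  rw [hj.injective.mem_set_image] at hx'
  obtain ⟨U, hU, hU'⟩ := h a ⟨ha, hx'⟩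
  refine ⟨j '' U, hj.image_mem_nhds.2 hU, ?_⟩
  rintro y ⟨⟨a₁, ha₁U, rfl⟩, hy⟩ z ⟨⟨a₂, ha₂U, rfl⟩, hz⟩
  simp only [OpenPartialHomeomorph.lift_openEmbedding_source, mem_inter_iff,
    hj.injective.mem_set_image] at hy hz
  rw [e.lift_openEmbedding_apply hj, e.lift_openEmbedding_apply hj,
    e'.lift_openEmbedding_apply hj, e'.lift_openEmbedding_apply hj]
  exact hU' a₁ ⟨ha₁U, hy⟩ a₂ ⟨ha₂U, hz⟩

variable {jA : A → M} {jB : Bm → M} {T : OpenPartialHomeomorph A Bm}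

omit [TopologicalSpace M] in
/-- On an open gluing, a point `jA a` lies in the pushed-forward source `jB '' s` iff `a` is
glued (`a ∈ T.source`) to a point `T a ∈ s`. [folklore] -/
theorem apply_mem_image_iff_of_glue (hT : ∀ a b, jA a = jB b ↔ a ∈ T.source ∧ T a = b)
    {a : A} {s : Set Bm} : jA a ∈ jB '' s ↔ a ∈ T.source ∧ T a ∈ s := by
  constructor
  · rintro ⟨b, hb, hba⟩
    obtain ⟨haT, rfl⟩ := (hT a b).1 hba.symm
    exact ⟨haT, hb⟩
  · rintro ⟨haT, has⟩
    exact ⟨T a, has, ((hT a (T a)).2 ⟨haT, rfl⟩).symm⟩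

/-- **Compatibility is transported across an open gluing** (`jA`, `jB` open embeddings glued
along `T`, i.e. `jA a = jB b ↔ a ∈ T.source ∧ T a = b`): if the flow box `T.trans e'` (the box
`e'` of the second piece read on the first piece through the gluing map) is compatible with the
box `e` of the first piece, then `e'.lift_openEmbedding hjB` is compatible with
`e.lift_openEmbedding hjA` on `M`. [folklore] -/
theorem RelCompat.lift_of_trans (hjA : IsOpenEmbedding jA) (hjB : IsOpenEmbedding jB)
    (hT : ∀ a b, jA a = jB b ↔ a ∈ T.source ∧ T a = b) {r : ℝ → ℝ → Prop}
    {e : OpenPartialHomeomorph A (B × ℝ)} {e' : OpenPartialHomeomorph Bm (B × ℝ)}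
    (h : RelCompat r e (T.trans e')) :
    RelCompat r (e.lift_openEmbedding hjA) (e'.lift_openEmbedding hjB) := by
  rintro x ⟨hx, hx'⟩
  rw [OpenPartialHomeomorph.lift_openEmbedding_source] at hx hx'
  obtain ⟨a, ha, rfl⟩ := hx
  rw [apply_mem_image_iff_of_glue hT] at hx'
  obtain ⟨U, hU, hU'⟩ := h a ⟨ha, by rw [OpenPartialHomeomorph.trans_source]; exact hx'⟩
  refine ⟨jA '' U, hjA.image_mem_nhds.2 hU, ?_⟩
  rintro y ⟨⟨a₁, ha₁U, rfl⟩, hy⟩ z ⟨⟨a₂, ha₂U, rfl⟩, hz⟩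
  simp only [OpenPartialHomeomorph.lift_openEmbedding_source, mem_inter_iff,
    hjA.injective.mem_set_image, apply_mem_image_iff_of_glue hT] at hy hz
  have hy' : a₁ ∈ U ∩ (e.source ∩ (T.trans e').source) :=
    ⟨ha₁U, hy.1, by rw [OpenPartialHomeomorph.trans_source]; exact hy.2⟩
  have hz' : a₂ ∈ U ∩ (e.source ∩ (T.trans e').source) :=
    ⟨ha₂U, hz.1, by rw [OpenPartialHomeomorph.trans_source]; exact hz.2⟩
  have h₁ : jA a₁ = jB (T a₁) := (hT a₁ (T a₁)).2 ⟨hy.2.1, rfl⟩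
  have h₂ : jA a₂ = jB (T a₂) := (hT a₂ (T a₂)).2 ⟨hz.2.1, rfl⟩
  rw [e.lift_openEmbedding_apply hjA, e.lift_openEmbedding_apply hjA, h₁, h₂,
    e'.lift_openEmbedding_apply hjB, e'.lift_openEmbedding_apply hjB]
  exact hU' a₁ hy' a₂ hz'

/-- **Compatibility is transported across an open gluing**, converse direction: if the box `e`
of the first piece is compatible with `T.trans e'`, then `e.lift_openEmbedding hjA` is
compatible with `e'.lift_openEmbedding hjB` on `M`. [folklore] -/
theorem RelCompat.lift_of_trans' (hjA : IsOpenEmbedding jA) (hjB : IsOpenEmbedding jB)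
    (hT : ∀ a b, jA a = jB b ↔ a ∈ T.source ∧ T a = b) {r : ℝ → ℝ → Prop}
    {e : OpenPartialHomeomorph A (B × ℝ)} {e' : OpenPartialHomeomorph Bm (B × ℝ)}
    (h : RelCompat r (T.trans e') e) :
    RelCompat r (e'.lift_openEmbedding hjB) (e.lift_openEmbedding hjA) := by
  rintro x ⟨hx', hx⟩
  rw [OpenPartialHomeomorph.lift_openEmbedding_source] at hx hx'
  obtain ⟨a, ha, rfl⟩ := hx
  rw [apply_mem_image_iff_of_glue hT] at hx'
  obtain ⟨U, hU, hU'⟩ := h a ⟨by rw [OpenPartialHomeomorph.trans_source]; exact hx', ha⟩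
  refine ⟨jA '' U, hjA.image_mem_nhds.2 hU, ?_⟩
  rintro y ⟨⟨a₁, ha₁U, rfl⟩, hy⟩ z ⟨⟨a₂, ha₂U, rfl⟩, hz⟩
  simp only [OpenPartialHomeomorph.lift_openEmbedding_source, mem_inter_iff,
    hjA.injective.mem_set_image, apply_mem_image_iff_of_glue hT] at hy hz
  have hy' : a₁ ∈ U ∩ ((T.trans e').source ∩ e.source) :=
    ⟨ha₁U, by rw [OpenPartialHomeomorph.trans_source]; exact hy.1, hy.2⟩
  have hz' : a₂ ∈ U ∩ ((T.trans e').source ∩ e.source) :=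
    ⟨ha₂U, by rw [OpenPartialHomeomorph.trans_source]; exact hz.1, hz.2⟩
  have h₁ : jA a₁ = jB (T a₁) := (hT a₁ (T a₁)).2 ⟨hy.1.1, rfl⟩
  have h₂ : jA a₂ = jB (T a₂) := (hT a₂ (T a₂)).2 ⟨hz.1.1, rfl⟩
  rw [e.lift_openEmbedding_apply hjA, e.lift_openEmbedding_apply hjA, h₁, h₂,
    e'.lift_openEmbedding_apply hjB, e'.lift_openEmbedding_apply hjB]
  exact hU' a₁ hy' a₂ hz'

/-! ## Pushing a foliated atlas forward along an open embedding -/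

/-- The **pushed-forward flow boxes** of a foliation `F` of `A` along an open embedding
`j : A → M`: the boxes `e.lift_openEmbedding hj` (source `j '' e.source`, value `e a` at `j a`)
for `e ∈ F.atlas`. [folklore] -/
def liftAtlas (F : Foliation B A) {j : A → M} (hj : IsOpenEmbedding j) :
    Set (OpenPartialHomeomorph M (B × ℝ)) :=
  (fun e ↦ e.lift_openEmbedding hj) '' F.atlas

variable (F : Foliation B A) {j : A → M} (hj : IsOpenEmbedding j)

/-- Membership in the pushed-forward atlas. [folklore] -/
theorem mem_liftAtlas_iff {e : OpenPartialHomeomorph M (B × ℝ)} :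
    e ∈ F.liftAtlas hj ↔ ∃ e₀ ∈ F.atlas, e₀.lift_openEmbedding hj = e := Iff.rfl

/-- The push-forward of a flow box of `F` belongs to the pushed-forward atlas. [folklore] -/
theorem lift_mem_liftAtlas {e : OpenPartialHomeomorph A (B × ℝ)} (he : e ∈ F.atlas) :
    e.lift_openEmbedding hj ∈ F.liftAtlas hj := ⟨e, he, rfl⟩

/-- Pushed-forward flow boxes are onto the whole box `B × ℝ`. [folklore] -/
theorem target_eq_of_mem_liftAtlas {e : OpenPartialHomeomorph M (B × ℝ)}
    (he : e ∈ F.liftAtlas hj) : e.target = univ := by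
  obtain ⟨e₀, he₀, rfl⟩ := he
  rw [OpenPartialHomeomorph.lift_openEmbedding_target, F.target_eq e₀ he₀]

/-- The pushed-forward flow boxes cover the image of `j`. [folklore] -/
theorem exists_mem_liftAtlas_source (a : A) : ∃ e ∈ F.liftAtlas hj, j a ∈ e.source := by
  obtain ⟨e₀, he₀, ha⟩ := F.exists_mem_source a
  exact ⟨_, F.lift_mem_liftAtlas hj he₀, mem_image_of_mem j ha⟩

/-- The source of a pushed-forward flow box lies in the image of `j`. [folklore] -/
theorem source_subset_range_of_mem_liftAtlas {e : OpenPartialHomeomorph M (B × ℝ)}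
    (he : e ∈ F.liftAtlas hj) : e.source ⊆ range j := by
  obtain ⟨e₀, -, rfl⟩ := he
  rw [OpenPartialHomeomorph.lift_openEmbedding_source]
  exact image_subset_range _ _

/-- The pushed-forward flow boxes are pairwise plaque compatible. [folklore] -/
theorem relCompat_eq_liftAtlas :
    ∀ e ∈ F.liftAtlas hj, ∀ e' ∈ F.liftAtlas hj, RelCompat (· = ·) e e' := by
  rintro e ⟨e₀, he₀, rfl⟩ e' ⟨e₀', he₀', rfl⟩
  exact (F.locally_plaque_iff he₀ he₀').lift hj

/-- The pushed-forward flow boxes of a transversely oriented foliation are pairwise compatible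
for `<`. [folklore] -/
theorem relCompat_lt_liftAtlas (ho : F.IsTransverselyOriented) :
    ∀ e ∈ F.liftAtlas hj, ∀ e' ∈ F.liftAtlas hj, RelCompat (· < ·) e e' := by
  rintro e ⟨e₀, he₀, rfl⟩ e' ⟨e₀', he₀', rfl⟩
  exact (show RelCompat (· < ·) e₀ e₀' from ho e₀ he₀ e₀' he₀').lift hj

variable {F hj} {G : Foliation B M}

/-- **`j` maps plaques into plaques**: if the foliation `G` of `M` contains the pushed-forward
flow boxes of `F`, points on a common plaque of `F` map to points on a common plaque of `G`.
[folklore] -/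
theorem SamePlaque.map_of_liftAtlas_subset (hG : F.liftAtlas hj ⊆ G.atlas) {a a' : A}
    (h : F.SamePlaque a a') : G.SamePlaque (j a) (j a') := by
  obtain ⟨e, he, ha, ha', h⟩ := h
  refine ⟨e.lift_openEmbedding hj, hG (F.lift_mem_liftAtlas hj he), mem_image_of_mem j ha,
    mem_image_of_mem j ha', ?_⟩
  rwa [e.lift_openEmbedding_apply hj, e.lift_openEmbedding_apply hj]

/-- Transport of generated equivalence relations along a map of relations. [folklore] -/
theorem eqvGen_map {α β : Type*} {r : α → α → Prop} {s : β → β → Prop} (f : α → β)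
    (h : ∀ a b, r a b → s (f a) (f b)) {a b : α} (hab : Relation.EqvGen r a b) :
    Relation.EqvGen s (f a) (f b) := by
  induction hab with
  | rel a b hab => exact Relation.EqvGen.rel _ _ (h a b hab)
  | refl a => exact Relation.EqvGen.refl _
  | symm a b _ ih => exact Relation.EqvGen.symm _ _ ih
  | trans a b c _ _ ih₁ ih₂ => exact Relation.EqvGen.trans _ _ _ ih₁ ih₂

/-- **`j` maps leaves into leaves**: if `G` contains the pushed-forward flow boxes of `F`, the
image of the leaf of `F` through `a` lies in the leaf of `G` through `j a`. [folklore] -/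
theorem image_leaf_subset_leaf (hG : F.liftAtlas hj ⊆ G.atlas) (a : A) :
    j '' F.leaf a ⊆ G.leaf (j a) := by
  rintro _ ⟨a', ha', rfl⟩
  exact eqvGen_map j (fun _ _ h ↦ h.map_of_liftAtlas_subset hG) ha'

/-- **`j` maps closed transversals to closed transversals**: if `G` contains the pushed-forward
flow boxes of `F` and `γ` is a closed transversal of `F`, then `j ∘ γ` is a closed transversal
of `G` (same flow boxes, same heights). [folklore] -/
theorem IsClosedTransversal.comp_of_liftAtlas_subset (hG : F.liftAtlas hj ⊆ G.atlas) {γ : ℝ → A}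
    (hγ : F.IsClosedTransversal γ) : G.IsClosedTransversal (j ∘ γ) := by
  obtain ⟨hc, hp, h⟩ := hγ
  refine ⟨hj.continuous.comp hc, hp.comp j, fun s ↦ ?_⟩
  obtain ⟨e, he, ε, hε, hmaps, hmono⟩ := h s
  refine ⟨e.lift_openEmbedding hj, hG (F.lift_mem_liftAtlas hj he), ε, hε, fun r hr ↦ ?_, ?_⟩
  · rw [OpenPartialHomeomorph.lift_openEmbedding_source]
    exact mem_image_of_mem j (hmaps hr)
  · simp only [comp_apply, e.lift_openEmbedding_apply hj]
    exact hmono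

/-! ## Transport along a homeomorphism -/

/-- **Transport of a foliation along a homeomorphism** `φ : M ≃ₜ N`: the foliated atlas of `N`
consisting of the flow boxes `e ∘ φ⁻¹` (`e.lift_openEmbedding φ.isOpenEmbedding`), `e ∈ F.atlas`.
[folklore] -/
def map (F : Foliation B M) (φ : M ≃ₜ N) : Foliation B N where
  atlas := F.liftAtlas φ.isOpenEmbedding
  target_eq e he := F.target_eq_of_mem_liftAtlas φ.isOpenEmbedding he
  exists_mem_source y := by
    obtain ⟨x, rfl⟩ := φ.surjective y
    exact F.exists_mem_liftAtlas_source φ.isOpenEmbedding x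
  locally_plaque := F.relCompat_eq_liftAtlas φ.isOpenEmbedding

variable (F' : Foliation B M) (φ : M ≃ₜ N)

/-- The atlas of the transported foliation is the pushed-forward atlas. [folklore] -/
theorem map_atlas : (F'.map φ).atlas = F'.liftAtlas φ.isOpenEmbedding := rfl

/-- Points on a common plaque of the transported foliation come from points on a common plaque.
[folklore] -/
theorem samePlaque_map_iff {x y : M} : (F'.map φ).SamePlaque (φ x) (φ y) ↔ F'.SamePlaque x y := by
  refine ⟨?_, fun h ↦ h.map_of_liftAtlas_subset subset_rfl⟩
  rintro ⟨e, ⟨e₀, he₀, rfl⟩, hx, hy, h⟩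
  rw [OpenPartialHomeomorph.lift_openEmbedding_source, φ.injective.mem_set_image] at hx hy
  rw [e₀.lift_openEmbedding_apply, e₀.lift_openEmbedding_apply] at h
  exact ⟨e₀, he₀, hx, hy, h⟩

/-- **The leaves of the transported foliation are the images of the leaves.** [folklore] -/
theorem leaf_map (x : M) : (F'.map φ).leaf (φ x) = φ '' F'.leaf x := by
  refine Subset.antisymm ?_ (image_leaf_subset_leaf subset_rfl x)
  intro y hy
  obtain ⟨y, rfl⟩ := φ.surjective y
  refine mem_image_of_mem φ ?_
  have key : ∀ {u v : N}, Relation.EqvGen (F'.map φ).SamePlaque u v →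
      Relation.EqvGen F'.SamePlaque (φ.symm u) (φ.symm v) := fun h ↦
    eqvGen_map φ.symm (fun u v huv ↦ by
      rw [← φ.apply_symm_apply u, ← φ.apply_symm_apply v, samePlaque_map_iff] at huv
      exact huv) h
  simpa only [mem_leaf_iff, Homeomorph.symm_apply_apply] using key hy

/-- Transport along a homeomorphism preserves transverse orientation. [folklore] -/
theorem isTransverselyOriented_map (ho : F'.IsTransverselyOriented) :
    (F'.map φ).IsTransverselyOriented :=
  F'.relCompat_lt_liftAtlas φ.isOpenEmbedding ho

/-- Transport along a homeomorphism preserves closed transversals. [folklore] -/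
theorem IsClosedTransversal.map {γ : ℝ → M} (hγ : F'.IsClosedTransversal γ) :
    (F'.map φ).IsClosedTransversal (φ ∘ γ) :=
  hγ.comp_of_liftAtlas_subset subset_rfl

/-- Transport along a homeomorphism preserves tautness. [folklore] -/
theorem isTaut_map (ht : F'.IsTaut) : (F'.map φ).IsTaut := fun y ↦ by
  obtain ⟨x, rfl⟩ := φ.surjective y
  obtain ⟨γ, hγ, s, hs⟩ := ht x
  refine ⟨φ ∘ γ, hγ.map F' φ, s, ?_⟩
  rw [leaf_map]
  exact mem_image_of_mem φ hs

/-- Transport along a homeomorphism preserves compact leaves of genus `g`. [folklore] -/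
theorem HasCompactLeafOfGenus.map {g : ℕ} (h : F'.HasCompactLeafOfGenus g) :
    (F'.map φ).HasCompactLeafOfGenus g := by
  obtain ⟨x, hx, S, _, _, _, _, _, _, _, hS, hg, ⟨ψ⟩⟩ := h
  have hleaf := leaf_map F' φ x
  refine HasCompactLeafOfGenus.intro (φ x) ?_ S hS hg
    ((ψ.trans (φ.image (F'.leaf x))).trans (Homeomorph.setCongr hleaf.symm))
  rw [hleaf]
  exact hx.image φ.continuous

/-! ## Gluing along an open gluing -/

variable (FA : Foliation B A) (FB : Foliation B Bm)

/-- **The foliation glued from foliations of the two pieces of an open gluing.** Data: open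
embeddings `jA : A → M`, `jB : Bm → M` covering `M` and a partial homeomorphism `T` from `A` to
`Bm` describing the identifications (`jA a = jB b ↔ a ∈ T.source ∧ T a = b`); foliations `FA` of
`A` and `FB` of `Bm` such that every flow box `e` of `FA` and every flow box `e'` of `FB` read on
`A` through the gluing map (`T.trans e'`) are plaque compatible in both directions — i.e. `FA`
and the pull-back of `FB` define the same foliation of the glued region `T.source`. The glued
foliated atlas of `M` consists of the pushed-forward flow boxes of both pieces (an instance of
the union of two compatible foliated atlases, Hector–Hirsch, Ch. II 2.1.1). [folklore] -/
def glue (hjA : IsOpenEmbedding jA) (hjB : IsOpenEmbedding jB) (hcov : range jA ∪ range jB = univ)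
    (T : OpenPartialHomeomorph A Bm) (hT : ∀ a b, jA a = jB b ↔ a ∈ T.source ∧ T a = b)
    (hc : ∀ e ∈ FA.atlas, ∀ e' ∈ FB.atlas,
      RelCompat (· = ·) e (T.trans e') ∧ RelCompat (· = ·) (T.trans e') e) :
    Foliation B M where
  atlas := FA.liftAtlas hjA ∪ FB.liftAtlas hjB
  target_eq := by
    rintro e (he | he)
    · exact FA.target_eq_of_mem_liftAtlas hjA he
    · exact FB.target_eq_of_mem_liftAtlas hjB he
  exists_mem_source x := by
    obtain ⟨a, rfl⟩ | ⟨b, rfl⟩ := (Set.ext_iff.1 hcov x).2 (mem_univ x)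
    · obtain ⟨e, he, hae⟩ := FA.exists_mem_liftAtlas_source hjA a
      exact ⟨e, Or.inl he, hae⟩
    · obtain ⟨e, he, hbe⟩ := FB.exists_mem_liftAtlas_source hjB b
      exact ⟨e, Or.inr he, hbe⟩
  locally_plaque := by
    refine relCompat_union (FA.relCompat_eq_liftAtlas hjA) (FB.relCompat_eq_liftAtlas hjB) ?_
    rintro e ⟨e₀, he₀, rfl⟩ e' ⟨e₀', he₀', rfl⟩
    exact ⟨(hc e₀ he₀ e₀' he₀').1.lift_of_trans hjA hjB hT,
      (hc e₀ he₀ e₀' he₀').2.lift_of_trans' hjA hjB hT⟩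

variable {FA FB} {hjA : IsOpenEmbedding jA} {hjB : IsOpenEmbedding jB}
  {hcov : range jA ∪ range jB = univ} {hT : ∀ a b, jA a = jB b ↔ a ∈ T.source ∧ T a = b}
  {hc : ∀ e ∈ FA.atlas, ∀ e' ∈ FB.atlas,
    RelCompat (· = ·) e (T.trans e') ∧ RelCompat (· = ·) (T.trans e') e}

/-- The glued foliation contains the pushed-forward flow boxes of the first piece. [folklore] -/
theorem liftAtlas_subset_glue_left : FA.liftAtlas hjA ⊆ (glue FA FB hjA hjB hcov T hT hc).atlas :=
  subset_union_left

/-- The glued foliation contains the pushed-forward flow boxes of the second piece. [folklore] -/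
theorem liftAtlas_subset_glue_right : FB.liftAtlas hjB ⊆ (glue FA FB hjA hjB hcov T hT hc).atlas :=
  subset_union_right

/-- Leaves of the first piece map into leaves of the glued foliation. [folklore] -/
theorem image_leaf_subset_leaf_glue_left (a : A) :
    jA '' FA.leaf a ⊆ (glue FA FB hjA hjB hcov T hT hc).leaf (jA a) :=
  image_leaf_subset_leaf liftAtlas_subset_glue_left a

/-- Leaves of the second piece map into leaves of the glued foliation. [folklore] -/
theorem image_leaf_subset_leaf_glue_right (b : Bm) :
    jB '' FB.leaf b ⊆ (glue FA FB hjA hjB hcov T hT hc).leaf (jB b) :=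
  image_leaf_subset_leaf liftAtlas_subset_glue_right b

/-- **Gluing transversely oriented foliations**: if both pieces are transversely oriented and
the flow boxes of `FA` are compatible for `<`, in both directions, with the boxes `T.trans e'` of
`FB` read through the gluing map (the gluing preserves the transverse orientations), the glued
foliation is transversely oriented. [folklore] -/
theorem isTransverselyOriented_glue (hoA : FA.IsTransverselyOriented)
    (hoB : FB.IsTransverselyOriented)
    (ho : ∀ e ∈ FA.atlas, ∀ e' ∈ FB.atlas,
      RelCompat (· < ·) e (T.trans e') ∧ RelCompat (· < ·) (T.trans e') e) :
    (glue FA FB hjA hjB hcov T hT hc).IsTransverselyOriented := by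
  refine relCompat_union (FA.relCompat_lt_liftAtlas hjA hoA) (FB.relCompat_lt_liftAtlas hjB hoB) ?_
  rintro e ⟨e₀, he₀, rfl⟩ e' ⟨e₀', he₀', rfl⟩
  exact ⟨(ho e₀ he₀ e₀' he₀').1.lift_of_trans hjA hjB hT,
    (ho e₀ he₀ e₀' he₀').2.lift_of_trans' hjA hjB hT⟩

/-- **Tautness of a glued foliation** (the form used in Gabai (1987), proof of Cor. 8.2: "every
leaf of `𝓕′` intersects `∂N(k)` so the core of the filling intersects each leaf of `𝓕`"): if the
second piece is taut and every leaf of the first piece either meets a closed transversal of the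
first piece or reaches the glued region `T.source`, then the glued foliation is taut — closed
transversals of the pieces push forward, and a leaf reaching the glued region continues into a
leaf of the second piece. [cite: GabaiJDG1987, proof of Cor. 8.2] -/
theorem isTaut_glue
    (hA : ∀ a : A, (∃ γ, FA.IsClosedTransversal γ ∧ ∃ s, γ s ∈ FA.leaf a) ∨
      ∃ a' ∈ FA.leaf a, a' ∈ T.source)
    (hB : FB.IsTaut) : (glue FA FB hjA hjB hcov T hT hc).IsTaut := by
  set G := glue FA FB hjA hjB hcov T hT hc
  -- the leaf of `G` through a point of the second piece meets a pushed-forward transversal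
  have keyB : ∀ b : Bm, ∃ γ, G.IsClosedTransversal γ ∧ ∃ s, γ s ∈ G.leaf (jB b) := fun b ↦ by
    obtain ⟨γ, hγ, s, hs⟩ := hB b
    exact ⟨jB ∘ γ, hγ.comp_of_liftAtlas_subset liftAtlas_subset_glue_right, s,
      image_leaf_subset_leaf_glue_right b (mem_image_of_mem jB hs)⟩
  intro x
  obtain ⟨a, rfl⟩ | ⟨b, rfl⟩ := (Set.ext_iff.1 hcov x).2 (mem_univ x)
  · obtain ⟨γ, hγ, s, hs⟩ | ⟨a', ha', ha'T⟩ := hA a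
    · exact ⟨jA ∘ γ, hγ.comp_of_liftAtlas_subset liftAtlas_subset_glue_left, s,
        image_leaf_subset_leaf_glue_left a (mem_image_of_mem jA hs)⟩
    · -- the leaf through `jA a` passes through `jA a' = jB (T a')`
      obtain ⟨γ, hγ, s, hs⟩ := keyB (T a')
      refine ⟨γ, hγ, s, ?_⟩
      have h₁ : jA a' ∈ G.leaf (jA a) := image_leaf_subset_leaf_glue_left a (mem_image_of_mem jA ha')
      rw [← leaf_eq_of_mem h₁, (hT a' (T a')).2 ⟨ha'T, rfl⟩]
      exact hs
  · exact keyB b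

end Lift

end Foliation

end Literature.Topology.FourManifolds
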